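import Mathlib
import Literature.NumberTheory.Sieve.VaughanMeanValue
import Literature.NumberTheory.LFunctions.SiegelWalfisz
import Summits.Parity.GeneralizedHardyLittlewood.Theorems.LiouvilleShiftedTablesEHStubLowConductorAux

/-!
# Low conductors are harmless at every level (stub `stub_lowConductor`, crux `EH`)

Line `upward-replication-free-factorability` of stmt-Parity-11314.  For `0 < δ₀ < 1/2`, `θ < 1` and
`A > 0`, with the conductor cut `D = ⌊x^{1/2-δ₀}⌋₊`,
`∑_{q ≤ x^θ} max_{(a,q)=1} ‖Δ(x;q,a) − Δ♯_D(x;q,a)‖ = O(x/(log x)^A)`, where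
`Δ(x;q,a) = ψ(x;q,a) − x/φ(q)` and `Δ♯_D(x;q,a) = φ(q)⁻¹ ∑_{χ mod q, cond χ > D} χ(a⁻¹) ψ(x,χ)` is
its high-conductor part.  This is the Bombieri–Vinogradov argument (Davenport, *Multiplicative
Number Theory*, ch. 28; Cojocaru–Murty, *An Introduction to Sieve Methods*, §9.2; Vaughan, Acta
Arith. 37 (1980), Theorem 3) in which the level `x^{1/2}` enters only through the conductor, here
capped at `D ≤ x^{1/2-δ₀}` by fiat, so that the modulus range may be `q ≤ x^θ` for any `θ < 1`:

* Steps A–C (orthogonality, reindexing by the inducing primitive character, swapping the `q`- and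
  `d`-sums) are the registered auxiliary stub
  `LowConductorAux.stub_lowConductor_reduction` of the sibling file
  `LiouvilleShiftedTablesEHStubLowConductorAux.lean`:
  `∑_{q ≤ Q} max_a ‖Δ − Δ♯_D‖ ≤ W(Q) ∑_{d ≤ D} Φ(x; d) + ⌊log x/log 2⌋ Q log Q W(Q)`;
* Steps D–E (`sum_le_of_bounds`): the Siegel–Walfisz range `d ≤ (log x)^{A+6}`
  (`primTerm_le_of_SW`) and the Vaughan range `(log x)^{A+6} < d ≤ D` (`sum_Ioc_primTerm_le`), whose
  largest term is `x^{1/2} D log⁶ x ≤ x^{1-δ₀} log⁶ x`; the non-coprime remainders are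
  `≤ 2 x^θ log⁴ x`;
* Step F (`stub_lowConductor`): both analytic inputs are PROVED in the tree
  (`Literature.NumberTheory.Sieve.vaughan_meanValue_holds`,
  `Literature.NumberTheory.LFunctions.siegel_walfisz_holds`), and the side conditions hold
  eventually (`isLittleO_log_rpow_rpow_atTop`).

References: [DavenportMNT1980, ch. 28]; [CojocaruMurty2005, §9.2]; [Vaughan1980, Theorem 3].
-/

namespace Summit.Parity.GeneralizedHardyLittlewood.Theorems.EH.LowConductor

open Finset Filter Literature.NumberTheory.Sieve

set_option maxHeartbeats 1600000 in
/-- The pointwise bound under the eventual side conditions on `x` (Steps D–E of the tree's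
reduction with modulus range `Q = ⌊x^θ⌋₊`, conductor range `D = ⌊x^{1/2-δ₀}⌋₊`, small/large cut
`D₁ = ⌊(log x)^{A+6}⌋₊` and Siegel–Walfisz exponent `A₂ = 3A + 14`): the Siegel–Walfisz range
costs `D₁² (7√x + C₂2^{A₂}x/(log x)^{A₂})`, the Vaughan range
`C₁ log⁴(xD) [x/(D+1) + x^{5/6} + x^{1/2}D + x/(D₁+1) + x^{5/6}(1 + log D) + x^{1/2}D]` with
`x^{1/2} D ≤ x^{1-δ₀}`, the non-coprime remainders `≤ 2 x^θ log⁴ x`.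
[cite: CojocaruMurty2005, §9.2, proof of Theorem 9.2.1] -/
theorem sum_le_of_bounds {A C₁ C₂ δ₀ θ : ℝ} (hA : 0 < A) (hC₁ : 0 ≤ C₁) (hV : VaughanBound C₁)
    (hC₂ : 0 ≤ C₂) (hSW : SWBound (3 * A + 14) C₂) (hδ₀ : 0 ≤ δ₀) {x : ℝ} (hx : 9 ≤ x)
    (hL : 2 ≤ Real.log x) (hLA : (2 : ℝ) ^ (3 * A + 14) ≤ Real.log x)
    (hM : Real.log x ^ (3 * A + 14) ≤ x ^ (1 / 6 : ℝ))
    (hBδ : Real.log x ^ (A + 6) ≤ x ^ δ₀) (hBδ' : Real.log x ^ (A + 6) ≤ x ^ (1 / 2 - δ₀))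
    (hθL : 1 ≤ (1 - θ) * Real.log x) (hθ' : Real.log x ^ (A + 5) ≤ x ^ (1 - θ)) :
    ∑ q ∈ Finset.Icc 1 ⌊x ^ θ⌋₊, ⨆ a : (ZMod q)ˣ,
        ‖((Literature.NumberTheory.Sieve.ParityWave0.chebyshevPsiMod q (a : ZMod q) x -
                x / (Nat.totient q : ℝ) : ℝ) : ℂ) -
            ((Nat.totient q : ℂ))⁻¹ *
              ∑ χ ∈ (Finset.univ : Finset (DirichletCharacter ℂ q)) with
                  ⌊x ^ (1 / 2 - δ₀)⌋₊ < χ.conductor,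
                χ (a : ZMod q)⁻¹ * Literature.NumberTheory.Sieve.chebyshevPsiChar χ x‖ ≤
      (36 * C₁ + 2 * (C₂ * 2 ^ (3 * A + 14)) + 17) * x / Real.log x ^ A := by
  have hx0 : 0 < x := by linarith
  have hx1 : 1 ≤ x := by linarith
  have hx2 : (2 : ℝ) ≤ x := by linarith
  have hA₂0 : 0 < 3 * A + 14 := by linarith
  -- notation
  set L := Real.log x with hLdef
  set A₂ := 3 * A + 14 with hA₂def
  set B := A + 6 with hBdef
  set s := x ^ (1 / 2 : ℝ) with hsdef
  set u := x ^ (1 / 6 : ℝ) with hudef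
  set Q := ⌊x ^ θ⌋₊ with hQdef
  set D := ⌊x ^ (1 / 2 - δ₀)⌋₊ with hDdef
  set D₁ := ⌊L ^ B⌋₊ with hD₁def
  set E := 7 * Real.sqrt x + C₂ * 2 ^ A₂ * x / L ^ A₂ with hEdef
  set M := x / L ^ A with hMdef
  set M₂ := x / L ^ (A + 2) with hM₂def
  -- the empty modulus range
  rcases Nat.eq_zero_or_pos Q with hQ0 | hQ
  · rw [hQ0, Finset.Icc_eq_empty_of_lt zero_lt_one, Finset.sum_empty]; positivity
  -- positivity and power bookkeeping
  have hL0 : 0 < L := by linarith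
  have hL1 : 1 ≤ L := by linarith
  have hLp : ∀ e : ℝ, 0 < L ^ e := fun e => Real.rpow_pos_of_pos hL0 e
  have hLmono : ∀ {e₁ e₂ : ℝ}, e₁ ≤ e₂ → L ^ e₁ ≤ L ^ e₂ := fun h =>
    Real.rpow_le_rpow_of_exponent_le hL1 h
  have hLadd : ∀ e₁ e₂ : ℝ, L ^ (e₁ + e₂) = L ^ e₁ * L ^ e₂ := fun e₁ e₂ => Real.rpow_add hL0 e₁ e₂
  have hs0 : 0 < s := Real.rpow_pos_of_pos hx0 _
  have hu0 : 0 < u := Real.rpow_pos_of_pos hx0 _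
  have hss : s * s = x := by rw [hsdef, ← Real.rpow_add hx0]; norm_num
  have hsqrt : Real.sqrt x = s := Real.sqrt_eq_rpow x
  have h56 : 0 ≤ x ^ (5 / 6 : ℝ) := by positivity
  have h56u : x ^ (5 / 6 : ℝ) * u = x := by rw [hudef, ← Real.rpow_add hx0]; norm_num
  have hus : u ≤ s := Real.rpow_le_rpow_of_exponent_le hx1 (by norm_num)
  have hsx : s ≤ x := by
    calc s ≤ x ^ (1 : ℝ) := Real.rpow_le_rpow_of_exponent_le hx1 (by norm_num)
      _ = x := Real.rpow_one x
  have hux : u ≤ x := hus.trans hsx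
  have hP : ∀ e : ℝ, e ≤ A₂ → L ^ e ≤ u := fun e he => (hLmono he).trans hM
  have hL4 : L ^ (4 : ℝ) = L ^ 4 := by
    rw [show (4 : ℝ) = (4 : ℕ) by norm_num, Real.rpow_natCast]
  have hL2 : L ^ (2 : ℝ) = L ^ 2 := by
    rw [show (2 : ℝ) = (2 : ℕ) by norm_num, Real.rpow_natCast]
  have hLB : L ^ B = L ^ (A + 2) * L ^ 4 := by
    rw [← hL4, ← hLadd]; congr 1; simp only [hBdef]; ring
  have hLA2 : L ^ (A + 2) = L ^ A * L ^ 2 := by rw [← hL2, ← hLadd]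
  have hLA4 : L ^ (A + 4) = L ^ A * L ^ 4 := by rw [← hL4, ← hLadd]
  have hLA₂ : L ^ A₂ = (L ^ B * L ^ B) * L ^ (A + 2) := by
    rw [← hLadd, ← hLadd]; congr 1; simp only [hA₂def, hBdef]; ring
  have hM₂0 : 0 < M₂ := div_pos hx0 (hLp _)
  have hM₂M : L ^ 2 * M₂ = M := by
    rw [hM₂def, hMdef, hLA2]; field_simp
  have hE0' : 0 ≤ E := by rw [hEdef]; positivity
  have hC22 : 0 ≤ C₂ * 2 ^ A₂ := by positivity
  have hLB1 : 1 ≤ L ^ B := Real.one_le_rpow hL1 (by simp only [hBdef]; linarith)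
  -- facts about `Q`
  have hQle : (Q : ℝ) ≤ x ^ θ := Nat.floor_le (by positivity)
  have hQ1 : (1 : ℝ) ≤ Q := by exact_mod_cast hQ
  have hlogQ : Real.log Q ≤ θ * L := by
    rw [← Real.log_rpow hx0]; exact Real.log_le_log (by positivity) hQle
  have hlogQ0 : 0 ≤ Real.log Q := Real.log_nonneg hQ1
  have h1logQ : 1 + Real.log Q ≤ L := by nlinarith
  have hlogQL : Real.log Q ≤ L := by linarith
  have hW : totientInvSum Q ≤ L ^ 2 :=
    (totientInvSum_le Q).trans (pow_le_pow_left₀ (by linarith) h1logQ 2)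
  -- facts about `D`
  have hDle : (D : ℝ) ≤ x ^ (1 / 2 - δ₀) := Nat.floor_le (by positivity)
  have hDlt : x ^ (1 / 2 - δ₀) < D + 1 := Nat.lt_floor_add_one _
  have hDs : (D : ℝ) ≤ s := hDle.trans (Real.rpow_le_rpow_of_exponent_le hx1 (by linarith))
  have hD1 : 1 ≤ D := Nat.le_floor (by rw [Nat.cast_one]; exact hLB1.trans hBδ')
  have hD1' : (1 : ℝ) ≤ D := by exact_mod_cast hD1
  have hlogD : Real.log D ≤ L / 2 := by
    refine (Real.log_le_log (by linarith) hDs).trans (le_of_eq ?_)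
    rw [hsdef, Real.log_rpow hx0]; ring
  have h1logD : 1 + Real.log D ≤ L := by linarith
  have hLD : Real.log (x * D) ≤ 3 / 2 * L := by
    rw [Real.log_mul hx0.ne' (by positivity)]; linarith
  have hLD0 : 0 ≤ Real.log (x * D) := Real.log_nonneg (by nlinarith)
  have hLD4 : Real.log (x * D) ^ 4 ≤ 6 * L ^ 4 := by
    calc Real.log (x * D) ^ 4 ≤ (3 / 2 * L) ^ 4 := pow_le_pow_left₀ hLD0 hLD 4
      _ = 81 / 16 * L ^ 4 := by ring
      _ ≤ 6 * L ^ 4 := by gcongr; norm_num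
  -- facts about `D₁`
  have hD₁le : (D₁ : ℝ) ≤ L ^ B := Nat.floor_le (by positivity)
  have hD₁lt : L ^ B < D₁ + 1 := Nat.lt_floor_add_one _
  have hD₁1 : 1 ≤ D₁ := Nat.le_floor (by exact_mod_cast hLB1)
  -- Siegel–Walfisz applicability: `L^B ≤ (L/2)^{A₂}` and `1 ≤ (L/2)^{A₂}`
  have hSWapp : L ^ B ≤ (L / 2) ^ A₂ := by
    rw [Real.div_rpow hL0.le (by norm_num), le_div_iff₀ (by positivity)]
    calc L ^ B * 2 ^ A₂ ≤ L ^ B * L := by gcongr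
      _ = L ^ (B + 1) := by rw [hLadd B 1, Real.rpow_one]
      _ ≤ L ^ A₂ := hLmono (by simp only [hA₂def, hBdef]; linarith)
  have h1SW : (1 : ℝ) ≤ (L / 2) ^ A₂ := hLB1.trans hSWapp
  -- Steps A–C summed (E0) and the three ranges of `d`
  have hE0 := LowConductorAux.stub_lowConductor_reduction Q D hD1 x hx0.le
  have hE1 : primTerm x 1 ≤ 1 + E :=
    (primTerm_one_le x).trans (psiSubSelfSup_le_of_SW hA₂0 hC₂ hSW hx h1SW)
  have hE2 : ∀ d ∈ (Ioc 1 D).filter (fun d => d ≤ D₁), primTerm x d ≤ D₁ * E := by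
    intro d hd
    rw [Finset.mem_filter, Finset.mem_Ioc] at hd
    have hdD : (d : ℝ) ≤ D₁ := by exact_mod_cast hd.2
    calc primTerm x d ≤ d * E :=
          primTerm_le_of_SW hA₂0 hC₂ hSW hx hd.1.1 ((hdD.trans hD₁le).trans hSWapp)
      _ ≤ D₁ * E := by gcongr
  have hE4 := sum_Ioc_primTerm_le hC₁ hV hx2 hD1 hD₁1
  have hsplit : ∑ d ∈ Icc 1 D, primTerm x d ≤
      primTerm x 1 + (D₁ * (D₁ * E)) + ∑ d ∈ Ioc D₁ D, primTerm x d := by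
    rw [Finset.Icc_eq_cons_Ioc hD1, Finset.sum_cons, add_assoc,
      ← Finset.sum_filter_add_sum_filter_not (Ioc 1 D) (fun d => d ≤ D₁)]
    gcongr primTerm x 1 + (?_ + ?_)
    · calc ∑ d ∈ (Ioc 1 D).filter (fun d => d ≤ D₁), primTerm x d
          ≤ ∑ _d ∈ (Ioc 1 D).filter (fun d => d ≤ D₁), (D₁ : ℝ) * E := Finset.sum_le_sum hE2
        _ = ((Ioc 1 D).filter (fun d => d ≤ D₁)).card * (D₁ * E) := by
          rw [Finset.sum_const, nsmul_eq_mul]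
        _ ≤ D₁ * (D₁ * E) := by
          gcongr
          have : (Ioc 1 D).filter (fun d => d ≤ D₁) ⊆ Ioc 0 D₁ := fun d hd => by
            rw [Finset.mem_filter, Finset.mem_Ioc] at hd
            exact Finset.mem_Ioc.2 ⟨by omega, hd.2⟩
          have := Finset.card_le_card this
          rw [Nat.card_Ioc] at this
          exact_mod_cast this
    · refine Finset.sum_le_sum_of_subset_of_nonneg (fun d hd => ?_) fun d _ _ => primTerm_nonneg x d
      rw [Finset.mem_filter, Finset.mem_Ioc] at hd
      exact Finset.mem_Ioc.2 ⟨by omega, hd.1.2⟩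
  -- (i)–(iii): `1`, `√x` and `x/L^{A₂}` are at most `M₂ = x/L^{A+2}`
  have hi : 1 ≤ M₂ := by
    rw [hM₂def, le_div_iff₀ (hLp _), one_mul]
    exact (hP (A + 2) (by simp only [hA₂def]; linarith)).trans hux
  have hii : Real.sqrt x ≤ M₂ := by
    rw [hsqrt, hM₂def, le_div_iff₀ (hLp _)]
    calc s * L ^ (A + 2) ≤ s * s := by
          gcongr; exact (hP (A + 2) (by simp only [hA₂def]; linarith)).trans hus
      _ = x := hss
  have hiii : x / L ^ A₂ ≤ M₂ :=
    div_le_div_of_nonneg_left hx0.le (hLp _) (hLmono (by simp only [hA₂def]; linarith))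
  have hEM : E ≤ (7 + C₂ * 2 ^ A₂) * M₂ := by
    have h := mul_le_mul_of_nonneg_left hiii hC22
    calc E = 7 * Real.sqrt x + C₂ * 2 ^ A₂ * (x / L ^ A₂) := by rw [hEdef]; ring
      _ ≤ 7 * M₂ + C₂ * 2 ^ A₂ * M₂ := by gcongr
      _ = _ := by ring
  -- (iv) the small conductors: `D₁² E ≤ (7 + C₂ 2^{A₂}) M₂`
  have hiv : (D₁ : ℝ) * (D₁ * E) ≤ (7 + C₂ * 2 ^ A₂) * M₂ := by
    have h1 : L ^ B * L ^ B * Real.sqrt x ≤ M₂ := by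
      rw [hsqrt, hM₂def, le_div_iff₀ (hLp _)]
      calc L ^ B * L ^ B * s * L ^ (A + 2) = L ^ A₂ * s := by rw [hLA₂]; ring
        _ ≤ s * s := by gcongr; exact (hP A₂ le_rfl).trans hus
        _ = x := hss
    have h2 : L ^ B * L ^ B * (x / L ^ A₂) = M₂ := by
      rw [hLA₂, hM₂def]; field_simp
    calc (D₁ : ℝ) * (D₁ * E) = (D₁ * D₁) * E := by ring
      _ ≤ (L ^ B * L ^ B) * E := by gcongr
      _ = 7 * (L ^ B * L ^ B * Real.sqrt x) + C₂ * 2 ^ A₂ * (L ^ B * L ^ B * (x / L ^ A₂)) := by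
          rw [hEdef]; ring
      _ ≤ 7 * M₂ + C₂ * 2 ^ A₂ * M₂ := by rw [h2]; gcongr
      _ = _ := by ring
  -- (v) the large conductors: `≤ 36 C₁ M₂`
  have hv : ∑ d ∈ Ioc D₁ D, primTerm x d ≤ 36 * C₁ * M₂ := by
    have hxB : ∀ t : ℝ, t * L ^ B ≤ x → t ≤ x / L ^ B := fun t ht => (le_div_iff₀ (hLp B)).2 ht
    have t1 : x / (D + 1) ≤ x / L ^ B :=
      div_le_div_of_nonneg_left hx0.le (hLp B) (hBδ'.trans hDlt.le)
    have t2 : x ^ (5 / 6 : ℝ) ≤ x / L ^ B := hxB _ (by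
      calc x ^ (5 / 6 : ℝ) * L ^ B ≤ x ^ (5 / 6 : ℝ) * u := by
            gcongr; exact hP B (by simp only [hA₂def, hBdef]; linarith)
        _ = x := h56u)
    have t3 : s * D ≤ x / L ^ B := hxB _ (by
      calc s * D * L ^ B ≤ s * x ^ (1 / 2 - δ₀) * x ^ δ₀ := by gcongr
        _ = s * s := by rw [mul_assoc, ← Real.rpow_add hx0, sub_add_cancel]
        _ = x := hss)
    have t4 : x / (D₁ + 1) ≤ x / L ^ B := div_le_div_of_nonneg_left hx0.le (hLp B) hD₁lt.le
    have t5 : x ^ (5 / 6 : ℝ) * (1 + Real.log D) ≤ x / L ^ B := hxB _ (by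
      calc x ^ (5 / 6 : ℝ) * (1 + Real.log D) * L ^ B ≤ x ^ (5 / 6 : ℝ) * L * L ^ B := by gcongr
        _ = x ^ (5 / 6 : ℝ) * L ^ (B + 1) := by rw [hLadd B 1, Real.rpow_one]; ring
        _ ≤ x ^ (5 / 6 : ℝ) * u := by
            gcongr; exact hP _ (by simp only [hA₂def, hBdef]; linarith)
        _ = x := h56u)
    have hbr : x / (D + 1) + x ^ (5 / 6 : ℝ) + s * D +
        (x / (D₁ + 1) + x ^ (5 / 6 : ℝ) * (1 + Real.log D) + s * D) ≤ 6 * (x / L ^ B) := by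
      linarith only [t1, t2, t3, t4, t5]
    have hbr0 : 0 ≤ x / (D + 1) + x ^ (5 / 6 : ℝ) + s * D +
        (x / (D₁ + 1) + x ^ (5 / 6 : ℝ) * (1 + Real.log D) + s * D) := by positivity
    have hxLB : L ^ 4 * (x / L ^ B) = M₂ := by
      have h4 : (L ^ 4 : ℝ) ≠ 0 := by positivity
      rw [hLB, hM₂def, div_mul_eq_div_div, mul_div_assoc', mul_div_cancel_left₀ _ h4]
    calc ∑ d ∈ Ioc D₁ D, primTerm x d ≤ _ := hE4
      _ ≤ C₁ * (6 * L ^ 4) * (6 * (x / L ^ B)) :=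
          mul_le_mul (mul_le_mul_of_nonneg_left hLD4 hC₁) hbr hbr0 (by positivity)
      _ = 36 * C₁ * (L ^ 4 * (x / L ^ B)) := by ring
      _ = 36 * C₁ * M₂ := by rw [hxLB]
  -- assembling
  have hSum : ∑ d ∈ Icc 1 D, primTerm x d ≤ (36 * C₁ + 2 * (C₂ * 2 ^ A₂) + 15) * M₂ := by
    linarith
  have hSum0 : 0 ≤ ∑ d ∈ Icc 1 D, primTerm x d := Finset.sum_nonneg fun d _ => primTerm_nonneg x d
  have hWSum : totientInvSum Q * ∑ d ∈ Icc 1 D, primTerm x d ≤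
      L ^ 2 * ((36 * C₁ + 2 * (C₂ * 2 ^ A₂) + 15) * M₂) :=
    mul_le_mul hW hSum hSum0 (by positivity)
  have hR : (⌊L / Real.log 2⌋₊ : ℝ) * ((Q : ℝ) * Real.log Q * totientInvSum Q) ≤ 2 * M := by
    have hlog2 : (1 : ℝ) / 2 ≤ Real.log 2 := by
      have := Real.log_two_gt_d9; linarith
    have hfl : (⌊L / Real.log 2⌋₊ : ℝ) ≤ 2 * L := by
      refine (Nat.floor_le (by positivity)).trans ?_
      rw [div_le_iff₀ (by positivity)]; nlinarith
    have hQW : (Q : ℝ) * Real.log Q * totientInvSum Q ≤ x ^ θ * L * L ^ 2 :=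
      mul_le_mul (mul_le_mul hQle hlogQL hlogQ0 (by positivity)) hW (totientInvSum_nonneg Q)
        (by positivity)
    have hQW0 : 0 ≤ (Q : ℝ) * Real.log Q * totientInvSum Q :=
      mul_nonneg (mul_nonneg (Nat.cast_nonneg _) hlogQ0) (totientInvSum_nonneg Q)
    have hkey : x ^ θ * L ^ (A + 4) ≤ x := by
      calc x ^ θ * L ^ (A + 4) ≤ x ^ θ * x ^ (1 - θ) := by
            gcongr; exact (hLmono (by linarith)).trans hθ'
        _ = x := by rw [← Real.rpow_add hx0, add_sub_cancel, Real.rpow_one]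
    calc (⌊L / Real.log 2⌋₊ : ℝ) * ((Q : ℝ) * Real.log Q * totientInvSum Q)
        ≤ 2 * L * (x ^ θ * L * L ^ 2) := mul_le_mul hfl hQW hQW0 (by positivity)
      _ = 2 * (x ^ θ * L ^ (A + 4)) / L ^ A := by
          rw [hLA4]; field_simp
      _ ≤ 2 * x / L ^ A := by gcongr
      _ = 2 * M := by rw [hMdef, mul_div_assoc]
  calc _ ≤ _ := hE0
    _ ≤ L ^ 2 * ((36 * C₁ + 2 * (C₂ * 2 ^ A₂) + 15) * M₂) + 2 * M := add_le_add hWSum hR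
    _ = (36 * C₁ + 2 * (C₂ * 2 ^ A₂) + 17) * M := by rw [← hM₂M]; ring
    _ = _ := by rw [hMdef, mul_div_assoc]

/-- **Low conductors are harmless at every level** (registered stub `stub_lowConductor` of the line
`upward-replication-free-factorability` for the crux `EH`): for `0 < δ₀ < 1/2`, `θ < 1`, `A > 0`,
`∑_{q ≤ x^θ} max_{(a,q)=1} ‖Δ(x;q,a) − φ(q)⁻¹∑_{cond χ > ⌊x^{1/2−δ₀}⌋} χ(a⁻¹)ψ(x,χ)‖`
is `O(x/(log x)^A)`.
The Bombieri–Vinogradov reduction (Davenport ch. 28; Cojocaru–Murty §9.2; Vaughan 1980, Thm 3)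
with the conductor capped at `x^{1/2−δ₀}`, from the PROVED inputs
`Literature.NumberTheory.Sieve.vaughan_meanValue_holds` and
`Literature.NumberTheory.LFunctions.siegel_walfisz_holds`; the side conditions of
`sum_le_of_bounds` hold eventually (`isLittleO_log_rpow_rpow_atTop`).
[cite: DavenportMNT1980, ch. 28] -/
theorem stub_lowConductor :
    ∀ δ₀ : ℝ, 0 < δ₀ → δ₀ < 1 / 2 → ∀ θ : ℝ, θ < 1 → ∀ A : ℝ, 0 < A →
      (fun x : ℝ => ∑ q ∈ Finset.Icc 1 ⌊x ^ θ⌋₊, ⨆ a : (ZMod q)ˣ,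
          ‖((Literature.NumberTheory.Sieve.ParityWave0.chebyshevPsiMod q (a : ZMod q) x -
                  x / (Nat.totient q : ℝ) : ℝ) : ℂ) -
              ((Nat.totient q : ℂ))⁻¹ *
                ∑ χ ∈ (Finset.univ : Finset (DirichletCharacter ℂ q)) with
                    ⌊x ^ (1 / 2 - δ₀)⌋₊ < χ.conductor,
                  χ (a : ZMod q)⁻¹ * Literature.NumberTheory.Sieve.chebyshevPsiChar χ x‖) =O[Filter.atTop]
        fun x : ℝ => x / Real.log x ^ A := by
  intro δ₀ hδ₀ hδ θ hθ A hA
  obtain ⟨C₁, hC₁, hVB⟩ := vaughanBound_of_vaughan_meanValue vaughan_meanValue_holds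
  obtain ⟨C₂, hC₂, hSWB⟩ := swBound_of_siegel_walfisz
    Literature.NumberTheory.LFunctions.siegel_walfisz_holds (show (0 : ℝ) < 3 * A + 14 by linarith)
  refine Asymptotics.IsBigO.of_bound (36 * C₁ + 2 * (C₂ * 2 ^ (3 * A + 14)) + 17) ?_
  filter_upwards [eventually_ge_atTop (9 : ℝ),
    Real.tendsto_log_atTop.eventually_ge_atTop ((2 : ℝ) ^ (3 * A + 14) + 2),
    eventually_log_rpow_le_rpow (3 * A + 14) (by norm_num : (0 : ℝ) < 1 / 6),
    eventually_log_rpow_le_rpow (A + 6) hδ₀,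
    eventually_log_rpow_le_rpow (A + 6) (sub_pos.2 hδ),
    (Real.tendsto_log_atTop.const_mul_atTop (sub_pos.2 hθ)).eventually_ge_atTop 1,
    eventually_log_rpow_le_rpow (A + 5) (sub_pos.2 hθ)] with x hx hL2 hM hBδ hBδ' hθL hθ'
  have h2A : (0 : ℝ) ≤ 2 ^ (3 * A + 14) := by positivity
  have hL : 2 ≤ Real.log x := by linarith
  have hL0 : 0 < Real.log x := by linarith
  have hx0 : 0 < x := by linarith
  have hLA : (2 : ℝ) ^ (3 * A + 14) ≤ Real.log x := by linarith
  have h := sum_le_of_bounds hA hC₁ hVB hC₂ hSWB hδ₀.le hx hL hLA hM hBδ hBδ' hθL hθ'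
  rw [Real.norm_of_nonneg (Finset.sum_nonneg fun q _ => Real.iSup_nonneg fun a => norm_nonneg _),
    Real.norm_of_nonneg (by positivity), ← mul_div_assoc]
  exact h

end Summit.Parity.GeneralizedHardyLittlewood.Theorems.EH.LowConductor
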